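import Literature.MathematicalPhysics.QuantumFieldTheory.ConstructiveQFTWave0OddRPProofs
import HarnessLib

/-!
# Crux `LatticeGapOnTrajectory` (stmt-QuantumFields-10523), line `sparse-defect-orbit-window`:
# stub (A) `stub_oddRPCrossTilt` — odd-torus Osterwalder–Seiler positivity with a crossing tilt

Helper file (`--supports stmt-QuantumFields-10523`). On the torus `(ℤ/Lℤ)^d` with `L` odd,
`L ≥ 3`, for the link reflection `θ t = 1 - t` (`GaugeConfig.timeReflect`), a continuous matrix
representation `ρ` of the compact group `G`, `β ≥ 0`, tilts `0 ≤ t_p ≤ β` and every bounded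
measurable observable `F` depending only on the links of `P ∪ M`
(`WilsonOddRP.oPosEdges ∪ WilsonOddRP.oSharedEdges`):

  `0 ≤ ⟨ conj F(ΘU) · F(U) · exp(-∑_{p crossing} t_p Re tr ρ(U_p)) ⟩_{Λ,β}`,

the crossing plaquettes being the temporal plaquettes based in the slice `t = 0`
(`WilsonOddRP.IsOCrossPlaq`), i.e. the ones cut by the fixed link hyperplane `t = 1/2`.

The proof re-runs the covariant mechanism of `WilsonOddRP.integral_oddCov_nonneg` /
`wilsonExpectation_nonneg_of_oddCovariant` of the tree with the Gram coefficients
`WilsonOddRP.oCoeff ρ hρ (β - t_p)` rescaled per crossing plaquette: after the substitution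
`translateLow Y` (splitting the crossing links), the crossing weight `exp(β X)` of the measure and
the tilt combine into `exp(∑_{p crossing} (β - t_p) Re tr ρ(U'_p)) = exp(∑ᵢ aᵢ(z) conj aᵢ(ΘU))`
with `β - t_p ≥ 0`, and the abstract positivity lemma
`LatticeRP.integral_mul_conj_mul_exp_nonneg_of_shared` applies verbatim. With `t ≡ 0` the
statement is the tree's `wilsonExpectation_oddReflectionPositive`.

References: K. Osterwalder, E. Seiler, Ann. Phys. 110 (1978) 440, §2; E. Seiler, LNP 159 (1982),
Ch. 2; J. Fröhlich, R. Israel, E. Lieb, B. Simon, Comm. Math. Phys. 62 (1978) 1, Thm. 2.1.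
-/

set_option autoImplicit false

noncomputable section

namespace Summit.QuantumFields.YangMills.Cruxes.LatticeGapOnTrajectory.SparseDefectOrbitWindow

open scoped BigOperators ENNReal ComplexOrder ComplexConjugate
open MeasureTheory Literature.MathematicalPhysics.QuantumFieldTheory

/-! ## The tilted Gram expansion and the doubled integrand -/

section Helpers

open Finset WilsonOddRP Literature.RepresentationTheory.CompactGroups

variable {d L N : ℕ} [NeZero d] [NeZero L] [Fact (1 < L)]
variable {G : Type*} [Group G] [TopologicalSpace G] [IsTopologicalGroup G] [CompactSpace G]
  [MeasurableSpace G] [BorelSpace G]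
variable (ρ : G →* Matrix (Fin N) (Fin N) ℂ)

omit [MeasurableSpace G] [BorelSpace G] in
/-- The Gram identity for ONE crossing plaquette `p` with coupling `β' ≥ 0`:
`∑_{k,l,b} a_{(p,k,l,b)}(z) conj a_{(p,k,l,b)}(ΘU) = β' Re tr ρ((translateLow Y U)_p)`,
`z = splice_C(U, Y)`, for the coefficient functions `WilsonOddRP.oCoeff ρ hρ β'`. -/
theorem crossTilt_sum_oCoeff_plaq (hL : Odd L) (hρ : Continuous ρ) {β' : ℝ} (hβ' : 0 ≤ β')
    (U Y : GaugeConfig d L G) {p : Plaquette d L} (hp : IsOCrossPlaq p) :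
    ∑ klb : Fin N × Fin N × Bool,
        oCoeff ρ hρ β' (p, klb) (LatticeRP.splice lowerEdges (U, Y)) *
          conj (oCoeff ρ hρ β' (p, klb) U.timeReflect) =
      ((β' * WilsonRP.plaqRe ρ (translateLow Y U) p : ℝ) : ℂ) := by
  have hs : (Real.sqrt (β' / 2) : ℂ) * (Real.sqrt (β' / 2) : ℂ) = ((β' / 2 : ℝ) : ℂ) := by
    rw [← Complex.ofReal_mul, Real.mul_self_sqrt (by linarith)]
  rw [plaqRe_translateLow_of_isOCrossPlaq ρ hL hρ U Y hp, Finset.mul_sum, Complex.ofReal_sum,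
    Fintype.sum_prod_type]
  refine Finset.sum_congr rfl fun k _ => ?_
  rw [Finset.mul_sum, Complex.ofReal_sum, Fintype.sum_prod_type]
  refine Finset.sum_congr rfl fun l _ => ?_
  rw [Fintype.sum_bool]
  simp only [oCoeff, if_pos hp, ↓reduceIte, Bool.false_eq_true, map_mul, Complex.conj_ofReal,
    Complex.conj_conj]
  set u := CompactGroup.unitarize ρ hρ
    (WilsonRP.halfPlaq p (LatticeRP.splice lowerEdges (U, Y))) k l
  set v := CompactGroup.unitarize ρ hρ (WilsonRP.halfPlaq p U.timeReflect) k l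
  calc (Real.sqrt (β' / 2) : ℂ) * u * ((Real.sqrt (β' / 2) : ℂ) * conj v) +
        (Real.sqrt (β' / 2) : ℂ) * conj u * ((Real.sqrt (β' / 2) : ℂ) * v)
      = ((Real.sqrt (β' / 2) : ℂ) * (Real.sqrt (β' / 2) : ℂ)) *
          (u * conj v + conj (u * conj v)) := by
        simp only [map_mul, Complex.conj_conj]; ring
    _ = ((β' * (u * conj v).re : ℝ) : ℂ) := by
        rw [hs, Complex.add_conj]; push_cast; ring

omit [MeasurableSpace G] [BorelSpace G] in
/-- **The tilted crossing weight is a Gram kernel.** With the coefficient functions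
`aᵢ := WilsonOddRP.oCoeff ρ hρ (β - t_{i.1}) i` (coupling `β - t_p ≥ 0` on the crossing
plaquette `p = i.1`),
`∑ᵢ aᵢ(z) conj aᵢ(ΘU) = ∑_{p crossing} (β - t_p) Re tr ρ((translateLow Y U)_p)`,
`z = splice_C(U, Y)`. -/
theorem crossTilt_sum_oCoeff (hL : Odd L) (hρ : Continuous ρ) {β : ℝ} (t : Plaquette d L → ℝ)
    (htβ : ∀ p, t p ≤ β) (U Y : GaugeConfig d L G) :
    ∑ i : WilsonRP.CoeffIndex d L N,
        oCoeff ρ hρ (β - t i.1) i (LatticeRP.splice lowerEdges (U, Y)) *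
          conj (oCoeff ρ hρ (β - t i.1) i U.timeReflect) =
      ((∑ p ∈ univ.filter IsOCrossPlaq,
        (β - t p) * WilsonRP.plaqRe ρ (translateLow Y U) p : ℝ) : ℂ) := by
  rw [Complex.ofReal_sum, Finset.sum_filter, Fintype.sum_prod_type]
  refine Finset.sum_congr rfl fun p _ => ?_
  by_cases hp : IsOCrossPlaq p
  · rw [if_pos hp]
    exact crossTilt_sum_oCoeff_plaq ρ hL hρ (sub_nonneg.2 (htβ p)) U Y hp
  · rw [if_neg hp]
    simp [oCoeff, hp]

omit [NeZero L] [Fact (1 < L)] [MeasurableSpace G] [BorelSpace G] in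
/-- The tilted coefficient functions are bounded by `√(β/2)` (as `0 ≤ t_p`). -/
theorem crossTilt_norm_oCoeff_le (hρ : Continuous ρ) {β : ℝ} (t : Plaquette d L → ℝ)
    (ht0 : ∀ p, 0 ≤ t p) (i : WilsonRP.CoeffIndex d L N) (V : GaugeConfig d L G) :
    ‖oCoeff ρ hρ (β - t i.1) i V‖ ≤ Real.sqrt (β / 2) :=
  (norm_oCoeff_le ρ hρ _ i V).trans (Real.sqrt_le_sqrt (by linarith [ht0 i.1]))

omit [MeasurableSpace G] [BorelSpace G] in
/-- **The pointwise identity** after the substitution `U' = translateLow Y U`: for `F` depending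
only on the links of `P ∪ M`,
`e^{-β S(U')} conj F(ΘU') F(U') e^{-∑_{p crossing} t_p Re tr ρ(U'_p)}
  = e^{-βN#plaq} (F e^{βA+βS_M/2})(z) conj (F e^{βA+βS_M/2})(ΘU) exp(∑ᵢ aᵢ(z) conj aᵢ(ΘU))`
with `z = splice_C(U, Y)` and the tilted coefficients `aᵢ = oCoeff ρ hρ (β - t_{i.1}) i`. -/
theorem crossTilt_integrand_translateLow (hL : Odd L) (hρ : Continuous ρ) {β : ℝ} (hβ : 0 ≤ β)
    (t : Plaquette d L → ℝ) (htβ : ∀ p, t p ≤ β) {F : GaugeConfig d L G → ℂ}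
    (hFdep : DependsOn F ((oPosEdges ∪ oSharedEdges : Finset (Edge d L)) : Set (Edge d L)))
    (U Y : GaugeConfig d L G) :
    (Real.exp (-β * wilsonAction ρ (translateLow Y U)) : ℂ) *
        (conj (F (translateLow Y U).timeReflect) * F (translateLow Y U) *
          ((Real.exp (-∑ p ∈ univ.filter IsOCrossPlaq,
            t p * WilsonRP.plaqRe ρ (translateLow Y U) p) : ℝ) : ℂ)) =
      (Real.exp (-β * (N * Fintype.card (Plaquette d L))) : ℂ) *
        (oObs ρ β F (LatticeRP.splice lowerEdges (U, Y)) * conj (oObs ρ β F U.timeReflect) *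
          Complex.exp (∑ i : WilsonRP.CoeffIndex d L N,
            oCoeff ρ hρ (β - t i.1) i (LatticeRP.splice lowerEdges (U, Y)) *
              conj (oCoeff ρ hρ (β - t i.1) i U.timeReflect))) := by
  -- `translateLow`, the splice and `Θ ∘ translateLow` agree with `U`, `U`, `Θ U` on `P ∪ M`
  have hPM : ∀ e : Edge d L,
      e ∈ ((oPosEdges ∪ oSharedEdges : Finset (Edge d L)) : Set (Edge d L)) →
      ¬ WilsonRP.IsLowerCross e := fun e he hc => by
    rw [Finset.coe_union] at he
    rcases he with he | he
    · exact not_isOPosEdge_of_isLowerCross hc (mem_oPosEdges.1 he)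
    · exact not_isOSharedEdge_of_isLowerCross hc (mem_oSharedEdges.1 he)
  have hcov : ∀ U Y : GaugeConfig d L G,
      conj (F (translateLow Y U).timeReflect) * F (translateLow Y U) =
        ∑ _k : Unit, F (LatticeRP.splice lowerEdges (U, Y)) * conj (F U.timeReflect) := by
    intro U Y
    rw [Fintype.sum_unique, mul_comm]
    congr 1
    · exact hFdep fun e he => translateLow_apply_of_not_isLowerCross Y U (hPM e he)
        |>.trans (splice_apply_of_not_isLowerCross U Y (hPM e he)).symm
    · congr 1
      refine hFdep fun e he => ?_
      have hne : ¬ WilsonRP.IsLowerCross (WilsonRP.edgeReflect e) := by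
        intro hc
        have := edgeReflect_of_isLowerCross (d := d) (L := L) hc
        rw [WilsonRP.edgeReflect_edgeReflect] at this
        rw [this] at he
        exact hPM _ he hc
      rw [WilsonRP.timeReflect_apply, WilsonRP.timeReflect_apply,
        translateLow_apply_of_not_isLowerCross Y U hne]
  -- the untilted identity of the tree (`oIntegrand_translateLow` with `g = F`)
  have h1 : (Real.exp (-β * wilsonAction ρ (translateLow Y U)) : ℂ) *
        (conj (F (translateLow Y U).timeReflect) * F (translateLow Y U)) =
      (Real.exp (-β * (N * Fintype.card (Plaquette d L))) : ℂ) *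
        (oObs ρ β F (LatticeRP.splice lowerEdges (U, Y)) * conj (oObs ρ β F U.timeReflect) *
          Complex.exp ((β * oCrossAction ρ (translateLow Y U) : ℝ) : ℂ)) := by
    have h := oIntegrand_translateLow ρ hL hρ hβ (Φ := fun V => conj (F V.timeReflect) * F V)
      (g := fun _ : Unit => F) hcov U Y
    rw [Fintype.sum_unique] at h
    rw [← sum_oCoeff_mul_conj ρ hL hρ hβ U Y]
    exact h
  -- the tilt combines with the crossing weight
  have h2 : ∑ p ∈ univ.filter IsOCrossPlaq, (β - t p) * WilsonRP.plaqRe ρ (translateLow Y U) p =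
      β * oCrossAction ρ (translateLow Y U) +
        -∑ p ∈ univ.filter IsOCrossPlaq, t p * WilsonRP.plaqRe ρ (translateLow Y U) p := by
    unfold oCrossAction
    rw [Finset.mul_sum, ← Finset.sum_neg_distrib, ← Finset.sum_add_distrib]
    exact Finset.sum_congr rfl fun p _ => by ring
  rw [crossTilt_sum_oCoeff ρ hL hρ t htβ U Y, h2, Complex.ofReal_add, Complex.exp_add,
    Complex.ofReal_exp
      (-∑ p ∈ univ.filter IsOCrossPlaq, t p * WilsonRP.plaqRe ρ (translateLow Y U) p)]
  linear_combination Complex.exp ((-∑ p ∈ univ.filter IsOCrossPlaq,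
    t p * WilsonRP.plaqRe ρ (translateLow Y U) p : ℝ) : ℂ) * h1

omit [Fact (1 < L)] in
/-- The doubled integrand (tilted coefficients) is measurable. -/
theorem crossTilt_measurable_doubled (hρ : Continuous ρ) (β : ℝ) (t : Plaquette d L → ℝ)
    {F : GaugeConfig d L G → ℂ} (hF : Measurable F) :
    Measurable fun q : GaugeConfig d L G × GaugeConfig d L G =>
      (Real.exp (-β * (N * Fintype.card (Plaquette d L))) : ℂ) *
        (oObs ρ β F (LatticeRP.splice lowerEdges q) * conj (oObs ρ β F q.1.timeReflect) *
          Complex.exp (∑ i : WilsonRP.CoeffIndex d L N,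
            oCoeff ρ hρ (β - t i.1) i (LatticeRP.splice lowerEdges q) *
              conj (oCoeff ρ hρ (β - t i.1) i q.1.timeReflect))) := by
  have hg' := measurable_oObs ρ hρ β hF
  have hconj : Measurable (starRingEnd ℂ : ℂ → ℂ) := Complex.continuous_conj.measurable
  have hsp : Measurable (LatticeRP.splice lowerEdges :
      GaugeConfig d L G × GaugeConfig d L G → GaugeConfig d L G) := LatticeRP.measurable_splice _
  have hΘ1 : Measurable fun p : GaugeConfig d L G × GaugeConfig d L G => p.1.timeReflect :=
    WilsonRP.measurable_timeReflect.comp measurable_fst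
  refine measurable_const.mul (((hg'.comp hsp).mul (hconj.comp (hg'.comp hΘ1))).mul
    (Complex.measurable_exp.comp (Finset.measurable_sum _ fun i _ => ?_)))
  exact ((measurable_oCoeff ρ hρ _ i).comp hsp).mul
    (hconj.comp ((measurable_oCoeff ρ hρ _ i).comp hΘ1))

omit [Fact (1 < L)] [MeasurableSpace G] [BorelSpace G] in
/-- The doubled integrand (tilted coefficients) is bounded. -/
theorem crossTilt_norm_doubled_le (hρ : Continuous ρ) (β : ℝ) (t : Plaquette d L → ℝ)
    (ht0 : ∀ p, 0 ≤ t p) {F : GaugeConfig d L G → ℂ} {CF : ℝ} (hFb : ∀ U, ‖F U‖ ≤ CF)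
    (q : GaugeConfig d L G × GaugeConfig d L G) :
    ‖(Real.exp (-β * (N * Fintype.card (Plaquette d L))) : ℂ) *
        (oObs ρ β F (LatticeRP.splice lowerEdges q) * conj (oObs ρ β F q.1.timeReflect) *
          Complex.exp (∑ i : WilsonRP.CoeffIndex d L N,
            oCoeff ρ hρ (β - t i.1) i (LatticeRP.splice lowerEdges q) *
              conj (oCoeff ρ hρ (β - t i.1) i q.1.timeReflect)))‖ ≤
      Real.exp (-β * (N * Fintype.card (Plaquette d L))) *
        ((|CF| * Real.exp ((|β| + |β / 2|) * (N * Fintype.card (Plaquette d L)))) *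
          (|CF| * Real.exp ((|β| + |β / 2|) * (N * Fintype.card (Plaquette d L)))) *
          Real.exp (Fintype.card (WilsonRP.CoeffIndex d L N) *
            (Real.sqrt (β / 2) * Real.sqrt (β / 2)))) := by
  rw [norm_mul, Complex.norm_real, Real.norm_eq_abs, abs_of_pos (Real.exp_pos _)]
  refine mul_le_mul_of_nonneg_left ?_ (Real.exp_pos _).le
  rw [norm_mul, norm_mul, Complex.norm_conj]
  refine mul_le_mul (mul_le_mul (norm_oObs_le ρ hρ β hFb _) (norm_oObs_le ρ hρ β hFb _)
    (norm_nonneg _) (by positivity)) ?_ (norm_nonneg _) (by positivity)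
  rw [Complex.norm_exp]
  refine Real.exp_le_exp.2 ((Complex.re_le_norm _).trans ?_)
  calc ‖∑ i : WilsonRP.CoeffIndex d L N,
          oCoeff ρ hρ (β - t i.1) i (LatticeRP.splice lowerEdges q) *
            conj (oCoeff ρ hρ (β - t i.1) i q.1.timeReflect)‖
      ≤ ∑ i : WilsonRP.CoeffIndex d L N,
          ‖oCoeff ρ hρ (β - t i.1) i (LatticeRP.splice lowerEdges q) *
            conj (oCoeff ρ hρ (β - t i.1) i q.1.timeReflect)‖ := norm_sum_le _ _
    _ ≤ ∑ _i : WilsonRP.CoeffIndex d L N, Real.sqrt (β / 2) * Real.sqrt (β / 2) :=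
        Finset.sum_le_sum fun i _ => by
          rw [norm_mul, Complex.norm_conj]
          exact mul_le_mul (crossTilt_norm_oCoeff_le ρ hρ t ht0 i _)
            (crossTilt_norm_oCoeff_le ρ hρ t ht0 i _) (norm_nonneg _) (Real.sqrt_nonneg _)
    _ = Fintype.card (WilsonRP.CoeffIndex d L N) * (Real.sqrt (β / 2) * Real.sqrt (β / 2)) := by
        rw [Finset.sum_const, Finset.card_univ, nsmul_eq_mul]

/-- **Reflection positivity of the un-normalised tilted Wilson weight on the odd torus**:
`0 ≤ ∫ e^{-β S(U)} conj F(ΘU) F(U) e^{-∑_{p crossing} t_p Re tr ρ(U_p)} ∏ dU_e` for `L` odd,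
`β ≥ 0`, `0 ≤ t_p ≤ β` and `F` depending only on the links of `P ∪ M`. Average over the
substitution `translateLow Y` (Haar invariance), rewrite pointwise by
`crossTilt_integrand_translateLow`, exchange the integrals, and apply the abstract mechanism
`LatticeRP.integral_mul_conj_mul_exp_nonneg_of_shared` with `g = F e^{βA+βS_M/2}` and the tilted
coefficients. -/
theorem crossTilt_integral_nonneg (hL : Odd L) (hρ : Continuous ρ) {β : ℝ} (hβ : 0 ≤ β)
    (t : Plaquette d L → ℝ) (ht0 : ∀ p, 0 ≤ t p) (htβ : ∀ p, t p ≤ β)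
    {F : GaugeConfig d L G → ℂ} (hF : Measurable F) {CF : ℝ} (hFb : ∀ U, ‖F U‖ ≤ CF)
    (hFdep : DependsOn F ((oPosEdges ∪ oSharedEdges : Finset (Edge d L)) : Set (Edge d L))) :
    0 ≤ ∫ U : GaugeConfig d L G, (Real.exp (-β * wilsonAction ρ U) : ℂ) *
        (conj (F U.timeReflect) * F U *
          ((Real.exp (-∑ p ∈ univ.filter IsOCrossPlaq, t p * WilsonRP.plaqRe ρ U p) : ℝ) : ℂ))
      ∂(LatticeRP.piMeasure (haarProbability G)) := by
  set μ : Measure (GaugeConfig d L G) := LatticeRP.piMeasure (haarProbability G) with hμ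
  have hFdep' : DependsOn F ((oPosEdges ∪ lowerEdges ∪ oSharedEdges : Finset (Edge d L)) :
      Set (Edge d L)) := fun U V hUV =>
    hFdep fun e he => hUV e (by
      rw [Finset.coe_union] at he
      rcases he with he | he
      · simp [mem_oPosEdges.1 he]
      · simp [mem_oSharedEdges.1 he])
  set H : GaugeConfig d L G → ℂ := fun U => (Real.exp (-β * wilsonAction ρ U) : ℂ) *
      (conj (F U.timeReflect) * F U *
        ((Real.exp (-∑ p ∈ univ.filter IsOCrossPlaq, t p * WilsonRP.plaqRe ρ U p) : ℝ) : ℂ))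
    with hH
  set R : GaugeConfig d L G × GaugeConfig d L G → ℂ := fun q =>
      (Real.exp (-β * (N * Fintype.card (Plaquette d L))) : ℂ) *
        (oObs ρ β F (LatticeRP.splice lowerEdges q) * conj (oObs ρ β F q.1.timeReflect) *
          Complex.exp (∑ i : WilsonRP.CoeffIndex d L N,
            oCoeff ρ hρ (β - t i.1) i (LatticeRP.splice lowerEdges q) *
              conj (oCoeff ρ hρ (β - t i.1) i q.1.timeReflect))) with hR
  have hHm : Measurable H :=
    (Complex.measurable_ofReal.comp
      ((WilsonRP.measurable_wilsonAction ρ hρ).const_mul (-β)).exp).mul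
      (((Complex.continuous_conj.measurable.comp (hF.comp WilsonRP.measurable_timeReflect)).mul
        hF).mul (Complex.measurable_ofReal.comp
          (Finset.measurable_sum (univ.filter IsOCrossPlaq)
            (fun p _ => (WilsonRP.measurable_plaqRe ρ hρ p).const_mul (t p))).neg.exp))
  have hRm : Measurable R := crossTilt_measurable_doubled ρ hρ β t hF
  have hHR : ∀ U Y, H (translateLow Y U) = R (U, Y) := fun U Y =>
    crossTilt_integrand_translateLow ρ hL hρ hβ t htβ hFdep U Y
  have hRi : Integrable R (μ.prod μ) :=
    Integrable.of_bound hRm.aestronglyMeasurable _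
      (ae_of_all _ (crossTilt_norm_doubled_le ρ hρ β t ht0 hFb))
  have step1 : ∫ U, H U ∂μ = ∫ Y, ∫ U, R (U, Y) ∂μ ∂μ := by
    have hY : ∀ Y, ∫ U, H U ∂μ = ∫ U, R (U, Y) ∂μ := fun Y => by
      rw [← LatticeRP.integral_comp_eq_of_measurePreserving (measurePreserving_translateLow Y) hHm]
      exact integral_congr_ae (ae_of_all _ fun U => hHR U Y)
    calc ∫ U, H U ∂μ = ∫ _Y, (∫ U, H U ∂μ) ∂μ := by
          rw [integral_const, probReal_univ, one_smul]
      _ = ∫ Y, ∫ U, R (U, Y) ∂μ ∂μ := integral_congr_ae (ae_of_all _ hY)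
  rw [step1, ← integral_prod_symm _ hRi]
  simp only [hR]
  rw [integral_const_mul]
  refine mul_nonneg (Complex.zero_le_real.2 (Real.exp_pos _).le) ?_
  exact LatticeRP.integral_mul_conj_mul_exp_nonneg_of_shared (haarProbability G) oSharedEdges
    oPosEdges lowerEdges GaugeConfig.timeReflect WilsonRP.measurePreserving_timeReflect
    (fun U e he => timeReflect_apply_of_mem_oSharedEdges hL U e he)
    (fun e he => dependsOn_timeReflect_apply hL e he) disjoint_oSharedEdges_oPosEdges
    disjoint_oSharedEdges_lowerEdges (g := oObs ρ β F)
    (a := fun i : WilsonRP.CoeffIndex d L N => oCoeff ρ hρ (β - t i.1) i)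
    (measurable_oObs ρ hρ β hF) (fun i => measurable_oCoeff ρ hρ (β - t i.1) i)
    (norm_oObs_le ρ hρ β hFb) (fun i U => crossTilt_norm_oCoeff_le ρ hρ t ht0 i U)
    (dependsOn_oObs ρ hL β hFdep') (fun i => dependsOn_oCoeff ρ hL hρ (β - t i.1) i)

end Helpers

/-! ## The registered stub -/

section Main

/-- **(A) Odd-torus reflection positivity with a crossing tilt.** For `L` odd, `L ≥ 3`, a
continuous matrix representation `ρ` of the compact group `G`, `β ≥ 0`, tilts `0 ≤ t_p ≤ β` and
every bounded measurable `F` depending only on the links of `P ∪ M`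
(`WilsonOddRP.oPosEdges ∪ WilsonOddRP.oSharedEdges`),
`0 ≤ ⟨ conj F(ΘU) · F(U) · exp(-∑_{p crossing} t_p Re tr ρ(U_p)) ⟩_{Λ,β}` for the link reflection
`θ t = 1 - t`; only the crossing plaquettes `WilsonOddRP.IsOCrossPlaq` (temporal, based in the
slice `t = 0`) are tilted, so that the net crossing coupling `β - t_p ≥ 0` keeps the
Osterwalder–Seiler Gram kernel of positive type. -/
theorem stub_oddRPCrossTilt :
    ∀ (d L N : ℕ) [NeZero d] [NeZero L] (G : Type) [Group G] [TopologicalSpace G]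
      [IsTopologicalGroup G] [CompactSpace G] [MeasurableSpace G] [BorelSpace G]
      (ρ : G →* Matrix (Fin N) (Fin N) ℂ), Odd L → 3 ≤ L → Continuous ρ →
    ∀ (β : ℝ), 0 ≤ β → ∀ (t : Plaquette d L → ℝ), (∀ p, 0 ≤ t p) → (∀ p, t p ≤ β) →
    ∀ (F : GaugeConfig d L G → ℂ), Measurable F → (∃ C : ℝ, ∀ U, ‖F U‖ ≤ C) →
      DependsOn F (↑(WilsonOddRP.oPosEdges ∪ WilsonOddRP.oSharedEdges : Finset (Edge d L))) →
      0 ≤ wilsonExpectation ρ β (fun U : GaugeConfig d L G =>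
        (starRingEnd ℂ) (F U.timeReflect) * F U *
          ((Real.exp (-∑ p ∈ Finset.univ.filter WilsonOddRP.IsOCrossPlaq,
              t p * WilsonRP.plaqRe ρ U p) : ℝ) : ℂ)) := by
  intro d L N _ _ G _ _ _ _ _ _ ρ hL hL3 hρ β hβ t ht0 htβ F hF hFb hFdep
  haveI : Fact (1 < L) := ⟨by omega⟩
  obtain ⟨CF, hFb⟩ := hFb
  have hdens : Measurable fun U : GaugeConfig d L G =>
      ENNReal.ofReal (Real.exp (-β * wilsonAction ρ U)) :=
    ENNReal.measurable_ofReal.comp ((WilsonRP.measurable_wilsonAction ρ hρ).const_mul (-β)).exp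
  unfold wilsonExpectation wilsonMeasure
  rw [integral_smul_measure]
  unfold wilsonWeight
  rw [integral_withDensity_eq_integral_toReal_smul hdens
    (ae_of_all _ fun _ => ENNReal.ofReal_lt_top)]
  simp_rw [ENNReal.toReal_ofReal (Real.exp_nonneg _), Complex.real_smul]
  refine mul_nonneg (Complex.zero_le_real.2 ENNReal.toReal_nonneg) ?_
  exact crossTilt_integral_nonneg ρ hL hρ hβ t ht0 htβ hF hFb hFdep

end Main

end Summit.QuantumFields.YangMills.Cruxes.LatticeGapOnTrajectory.SparseDefectOrbitWindow

end
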